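import Mathlib.NumberTheory.Padics.Complex
import Mathlib.Data.Nat.Factorization.Basic
import Mathlib.Data.Int.GCD
import Literature.NumberTheory.EllipticCurves.TateCurve.UniformizationAlgebraic
import Literature.NumberTheory.EllipticCurves.TateCurve.TateFormalAdditionIdentity
import Literature.NumberTheory.EllipticCurves.AbelianVarietyModelOfAddHom
import Literature.NumberTheory.EllipticCurves.WeierstrassAddLawCharts
import Literature.NumberTheory.EllipticCurves.WeierstrassAddHomPoints
import Literature.NumberTheory.EllipticCurves.WeierstrassSchemeNeg
import Literature.AnabelianGeometry.AbsoluteAnabelian.AbsTopIII.KummerFaithful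
import HarnessLib

/-!
# [AbsTopIII] Rmk. 1.5.3 (ii), first half of a CM-free witness: the Kummer tower
# `ℚ_p(p^{1/ℓ^∞})` is NOT Kummer-faithful

Proof-only companion (no new definitions) of `AbsTopIII/KummerFaithful.lean` (abc-iut-L4-t1,
p404026).  S. Mochizuki, *Topics in Absolute Anabelian Geometry III*, §1, Rmk. 1.5.3 (ii),
manuscript p. 33 (lit key `paper:url-5493eb38cbb7`): "by considering the example discussed in
Remark 1.2.3 (i.e., of abelian varieties over number fields), one may construct an example of a
field which is torally Kummer-faithful, but not Kummer-faithful".  The named fact `Rmk_1_5_3_ii`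
(FACT-LIST row F-0368) is the EXISTENCE statement
`∃ k, IsTorallyKummerFaithful k ∧ ¬ IsKummerFaithful k`; print's witness (Tamagawa: the field cut
out by a rank-one summand of the `p`-adic Tate module of a CM elliptic curve) needs CM theory.  This
file and its sequel give instead an elementary witness built from the TATE CURVE:

  `k := ℚ_p(α₀, α₁, α₂, …) ⊆ ℚ̄_p`,  `α₀ = p`,  `α_{n+1}^ℓ = α_n`  (`ℓ` a prime),

i.e. `ℚ_p` with a compatible system of `ℓ^n`-th roots of `p` adjoined (inside Mathlib's
`PadicAlgCl p`).  Over `k` the Tate curve `E_q`, `q = p`, has the `k`-rational points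
`P_n := φ(α_n)` (Tate's parametrisation `φ : k^× → E_q(k)`, kernel `q^ℤ`, the tree's THEOREM
`tatePointAlg` / `tatePointAlg_mul` / `tatePointAlg_eq_zero_iff`, Silverman ATAEC V.3.1) with
`ℓ · P_{n+1} = P_n`, `ℓ^n · P_n = O` and `P_1 ≠ O` (since `‖α₁‖ = p^{-1/ℓ} ∉ ‖q^ℤ‖`): they generate a
copy of `ℚ_ℓ/ℤ_ℓ` in `E_q(k)`, a DIVISIBLE subgroup, so `P_1 ∈ ⋂_N N · E_q(k)` is a non-zero
infinitely divisible point and condition (a) of Def. 1.5 FAILS for the abelian variety `E_q / k`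
(the tree's `WeierstrassCurve.abelianVarietyOfAddHom` with the Bosma–Lenstra addition morphism
`WeierstrassCurve.addHom`, whose `k`-points are Mathlib's `E_q(k)` by
`lift_pointEquiv_comp_addHom_of_field`).  Hence `k` is NOT Kummer-faithful
(`not_isKummerFaithful_of_rootTower`).  The sequel proves that `k` IS torally Kummer-faithful when
`ℓ ≠ p`.

Contents:
* `exists_abelianVariety_points_addEquiv` — for an elliptic curve `W/F`, an abelian variety `A/F`
  with `A(F) ≃ W(F)` (additively);
* `not_isKummerFaithful_of_divisible_point` — a non-zero infinitely divisible `F`-point on an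
  elliptic curve over `F` makes `F` non-Kummer-faithful;
* `exists_rootTower` — a compatible system of `ℓ^n`-th roots of `p` in `PadicAlgCl p`;
* `not_isKummerFaithful_of_rootTower` — every intermediate field of `ℚ̄_p / ℚ_p` containing such a
  system is not Kummer-faithful.

HONEST FRAMING: classical (Tate 1959 / Silverman ATAEC V.3.1); OUR kernel proof of an instance;
nothing here bears on [IUTchIII] Cor. 3.12. [cite: MochizukiAbsTopIII2015, Rmk 1.5.3 (ii) p.33]
[cite: SilvermanATAEC1994, Thm. V.3.1 (c) (PDF pp. 395–399)]
-/

noncomputable section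

open scoped Classical

namespace Literature.AnabelianGeometry.AbsoluteAnabelian.AbsTopIII

open CategoryTheory MonoidalCategory CartesianMonoidalCategory
open Literature.AlgebraicGeometry.Motives Literature.NumberTheory.EllipticCurves
open Literature.NumberTheory.EllipticCurves.TateCurve
open Literature.NumberTheory.EllipticCurves.SteinWuthrich2013

universe u

/-! ## §1. An elliptic curve with a non-zero infinitely divisible rational point -/

section Elliptic

variable {F : Type u} [Field F] (W : WeierstrassCurve F) [W.IsElliptic]

/-- **An elliptic curve is an abelian variety whose rational points are Mathlib's points**: for an
elliptic curve `W / F` there is an abelian variety `A / F` (the plane cubic `E_W` with the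
Bosma–Lenstra addition morphism, `WeierstrassCurve.abelianVarietyOfAddHom`) together with an
additive isomorphism `A(F) ≃ W(F)` (`WeierstrassCurve.pointEquiv`, additive by
`lift_pointEquiv_comp_addHom_of_field`). [cite: SilvermanAEC2009, III.3.6] -/
theorem exists_abelianVariety_points_addEquiv :
    ∃ A : AbelianVariety F, Nonempty (Additive (A.Points F) ≃+ (W.baseChange F).toAffine.Point) := by
  let A : AbelianVariety F := W.abelianVarietyOfAddHom W.addHom W.negHom
    W.lift_pointEquiv_comp_addHom W.pointEquiv_comp_negHom_geom
  refine ⟨A, ⟨AlgPoints.addEquivOfBijective (X := A.X) (L := F)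
    (fun P => (W.pointEquiv (L := F)).symm P) (W.pointEquiv (L := F)).symm.bijective ?_⟩⟩
  intro P Q
  obtain ⟨P', rfl⟩ := (W.pointEquiv (L := F)).surjective P
  obtain ⟨Q', rfl⟩ := (W.pointEquiv (L := F)).surjective Q
  change (W.pointEquiv (L := F)).symm (lift (W.pointEquiv P') (W.pointEquiv Q') ≫ W.addHom) = _
  rw [W.lift_pointEquiv_comp_addHom_of_field, Equiv.symm_apply_apply, Equiv.symm_apply_apply,
    Equiv.symm_apply_apply]

/-- **A non-zero infinitely divisible rational point violates Def. 1.5 (a)**: if `P ∈ W(F)`,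
`P ≠ O`, lies in `n · W(F)` for every `n ≥ 1`, then the abelian variety `E_W / F` has
`⋂_N N · E_W(F) ≠ {0}`. [cite: MochizukiAbsTopIII2015, Def 1.5 (a) p.32] -/
theorem exists_abelianVariety_not_divisibleElementsTrivial (P : (W.baseChange F).toAffine.Point)
    (hP : P ≠ 0) (hdiv : ∀ n : ℕ, 0 < n → ∃ Q : (W.baseChange F).toAffine.Point, n • Q = P) :
    ∃ A : AbelianVariety F, ¬ DivisibleElementsTrivial (A.Points F) := by
  obtain ⟨A, ⟨e⟩⟩ := exists_abelianVariety_points_addEquiv W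
  refine ⟨A, fun h => hP ?_⟩
  have hx : Additive.toMul (e.symm P) = 1 := by
    refine h.eq_one_of_forall_exists_pow _ fun n hn => ?_
    obtain ⟨Q, hQ⟩ := hdiv n hn
    refine ⟨Additive.toMul (e.symm Q), ?_⟩
    rw [← toMul_nsmul, ← map_nsmul, hQ]
  have : e.symm P = 0 := by
    rw [← ofMul_toMul (e.symm P), hx]
    rfl
  simpa using congrArg e this

/-- **A field over which some elliptic curve has a non-zero infinitely divisible rational point is
not Kummer-faithful** (the abelian-variety clause of Def. 1.5 fails already over `F` itself).
[cite: MochizukiAbsTopIII2015, Def 1.5 p.32] -/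
theorem not_isKummerFaithful_of_divisible_point (P : (W.baseChange F).toAffine.Point)
    (hP : P ≠ 0) (hdiv : ∀ n : ℕ, 0 < n → ∃ Q : (W.baseChange F).toAffine.Point, n • Q = P) :
    ¬ IsKummerFaithful F := by
  intro h
  obtain ⟨A, hA⟩ := exists_abelianVariety_not_divisibleElementsTrivial W P hP hdiv
  exact hA (h.abelianVariety F (Module.Finite.self F) A)

end Elliptic

/-! ## §2. Divisibility bookkeeping in an additive group -/

/-- If `x = ℓ^k · y_k` with `ℓ^{k+1} · y_k = 0` for every `k` (`ℓ` prime), then `x` is divisible by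
every positive integer: for `N = ℓ^a · b`, `ℓ ∤ b`, take `c` with `b c ≡ 1 (mod ℓ^{a+1})` and
`z := c · y_a` (the divisibility of `ℚ_ℓ/ℤ_ℓ`, as used for the Tate points below).
[cite: MochizukiAbsTopIII2015, Rmk 1.5.3 (ii) p.33] -/
theorem forall_exists_nsmul_eq_of_prime_tower {G : Type*} [AddCommGroup G] {ℓ : ℕ} (hℓ : ℓ.Prime)
    (x : G) (y : ℕ → G) (h1 : ∀ k, ℓ ^ k • y k = x) (h2 : ∀ k, ℓ ^ (k + 1) • y k = 0) :
    ∀ N : ℕ, 0 < N → ∃ z : G, N • z = x := by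
  intro N hN
  obtain ⟨a, b, hb, rfl⟩ := Nat.exists_eq_pow_mul_and_not_dvd hN.ne' ℓ hℓ.ne_one
  have hcop : Nat.Coprime b (ℓ ^ (a + 1)) :=
    (Nat.coprime_comm.mp ((Nat.Prime.coprime_iff_not_dvd hℓ).mpr hb)).pow_right _
  have hlt : 1 < ℓ ^ (a + 1) := Nat.one_lt_pow (Nat.succ_ne_zero a) hℓ.one_lt
  obtain ⟨c, -, hc⟩ := Nat.exists_mul_mod_eq_one_of_coprime hcop hlt
  refine ⟨c • y a, ?_⟩
  have hbc : b * c = ℓ ^ (a + 1) * (b * c / ℓ ^ (a + 1)) + 1 := by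
    conv_lhs => rw [← Nat.div_add_mod (b * c) (ℓ ^ (a + 1)), hc]
  have key : ℓ ^ a * (b * c) = (ℓ ^ a * (b * c / ℓ ^ (a + 1))) * ℓ ^ (a + 1) + ℓ ^ a := by
    conv_lhs => rw [hbc]
    ring
  calc (ℓ ^ a * b) • c • y a = (ℓ ^ a * (b * c)) • y a := by rw [smul_smul, mul_assoc]
    _ = (ℓ ^ a * (b * c / ℓ ^ (a + 1))) • (ℓ ^ (a + 1) • y a) + ℓ ^ a • y a := by
        rw [key, add_smul, mul_smul]
    _ = x := by rw [h2, smul_zero, zero_add, h1]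

/-! ## §3. The tower of `ℓ^n`-th roots of `p` in `ℚ̄_p` and the Tate points `φ(α_n)` -/

section Tower

variable (p ℓ : ℕ) [Fact p.Prime]

/-- A compatible system of `ℓ^n`-th roots of `p` exists in `ℚ̄_p = PadicAlgCl p` (algebraically
closed): `α₀ = p`, `α_{n+1}^ℓ = α_n` — the generators of the witness field of our proof of
Rmk. 1.5.3 (ii). [cite: MochizukiAbsTopIII2015, Rmk 1.5.3 (ii) p.33] -/
theorem exists_rootTower (hℓ : 0 < ℓ) :
    ∃ α : ℕ → PadicAlgCl p, α 0 = (p : PadicAlgCl p) ∧ ∀ n, α (n + 1) ^ ℓ = α n := by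
  let f : PadicAlgCl p → PadicAlgCl p := fun x => Classical.choose (IsAlgClosed.exists_pow_nat_eq x hℓ)
  have hf : ∀ x, f x ^ ℓ = x := fun x => Classical.choose_spec (IsAlgClosed.exists_pow_nat_eq x hℓ)
  exact ⟨fun n => Nat.rec (p : PadicAlgCl p) (fun _ x => f x) n, rfl, fun n => hf _⟩

variable {p ℓ} {α : ℕ → PadicAlgCl p} (h0 : α 0 = (p : PadicAlgCl p))
  (hα : ∀ n, α (n + 1) ^ ℓ = α n)

include h0 hα in
/-- `α_n^{ℓ^n} = p` (tower of the witness field). [cite: MochizukiAbsTopIII2015, Rmk 1.5.3 (ii) p.33] -/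
theorem rootTower_pow (n : ℕ) : α n ^ ℓ ^ n = (p : PadicAlgCl p) := by
  induction n with
  | zero => simpa using h0
  | succ n ih => rw [pow_succ', pow_mul, hα n, ih]

include h0 hα in
/-- `α_n ≠ 0` (tower of the witness field). [cite: MochizukiAbsTopIII2015, Rmk 1.5.3 (ii) p.33] -/
theorem rootTower_ne_zero (n : ℕ) : α n ≠ 0 := by
  intro h
  have key := rootTower_pow h0 hα n
  rw [h] at key
  rcases Nat.eq_zero_or_pos (ℓ ^ n) with hz | hpos
  · rw [hz, pow_zero] at key
    have h1 : (p : PadicAlgCl p) = ((1 : ℕ) : PadicAlgCl p) := by rw [← key, Nat.cast_one]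
    exact (Fact.out : p.Prime).ne_one (Nat.cast_injective h1)
  · rw [zero_pow hpos.ne'] at key
    exact (Nat.cast_ne_zero.mpr (Fact.out : p.Prime).ne_zero) key.symm

include hα in
/-- `‖α_n‖^{ℓ^n} = ‖α_0‖` (tower of the witness field). [cite: MochizukiAbsTopIII2015, Rmk 1.5.3 (ii) p.33] -/
theorem norm_rootTower_pow (n : ℕ) : ‖α n‖ ^ ℓ ^ n = ‖α 0‖ := by
  induction n with
  | zero => simp
  | succ n ih => rw [pow_succ', pow_mul, ← norm_pow, hα n, ih]

/-- `‖(p : ℚ̄_p)‖ = p⁻¹` (the Tate parameter `q = p` has `0 < ‖q‖ < 1`).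
[cite: SilvermanATAEC1994, Thm. V.3.1 (PDF p. 395)] -/
private theorem norm_natCast_padicAlgCl : ‖(p : PadicAlgCl p)‖ = (p : ℝ)⁻¹ := by
  rw [← map_natCast (algebraMap ℚ_[p] (PadicAlgCl p)) p]
  change ‖((p : ℚ_[p]) : PadicAlgCl p)‖ = _
  rw [PadicAlgCl.norm_extends, Padic.norm_p]

include h0 hα in
/-- **`α_1 ∉ q^ℤ` for `q = p`**: `‖α_1‖^ℓ = p⁻¹` while `‖q^m‖ = p^{-m}`, and `m ℓ = 1` has no
solution for a prime `ℓ`. [cite: SilvermanATAEC1994, Thm. V.3.1 (c) (PDF p. 395)] -/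
theorem rootTower_one_ne_zpow (hℓ : ℓ.Prime) (m : ℤ) :
    α 1 ≠ (algebraMap ℚ_[p] (PadicAlgCl p) (p : ℚ_[p])) ^ m := by
  intro h
  have hp : (1 : ℝ) < p := by exact_mod_cast (Fact.out : p.Prime).one_lt
  have hp0 : (0 : ℝ) < p := by positivity
  have h1 : ‖α 1‖ ^ ℓ = (p : ℝ)⁻¹ := by
    have := norm_rootTower_pow (α := α) hα 1
    rwa [pow_one, h0, norm_natCast_padicAlgCl] at this
  have h2 : ‖α 1‖ = (p : ℝ) ^ (-m) := by
    rw [h, norm_zpow, map_natCast, norm_natCast_padicAlgCl, inv_zpow', ]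
  rw [h2, ← zpow_natCast, ← zpow_mul, ← zpow_neg_one] at h1
  have h3 : -m * (ℓ : ℤ) = -1 := zpow_right_injective₀ hp0 hp.ne' h1
  have h4 : m * (ℓ : ℤ) = 1 := by linarith
  have h5 : (ℓ : ℤ) = 1 := Int.eq_one_of_mul_eq_one_left (by positivity) h4
  exact hℓ.ne_one (by exact_mod_cast h5)

variable (E : IntermediateField ℚ_[p] (PadicAlgCl p)) (hE : ∀ n, α n ∈ E)

/-- `‖(p : ℚ_p)‖ < 1` (the Tate parameter `q = p` has `‖q‖ < 1`).
[cite: SilvermanATAEC1994, Thm. V.3.1 (PDF p. 395)] -/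
private theorem norm_natCast_padic_lt_one : ‖(p : ℚ_[p])‖ < 1 := by
  rw [Padic.norm_p]
  exact inv_lt_one_of_one_lt₀ (by exact_mod_cast (Fact.out : p.Prime).one_lt)

/-- `(p : ℚ_p) ≠ 0` (the Tate parameter `q = p` is non-zero).
[cite: SilvermanATAEC1994, Thm. V.3.1 (PDF p. 395)] -/
private theorem natCast_padic_ne_zero : (p : ℚ_[p]) ≠ 0 := by
  exact_mod_cast (Fact.out : p.Prime).ne_zero

/-- `φ(u^m) = m · φ(u)` for Tate's map over an algebraic extension (from `tatePointAlg_mul` and the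
formal addition identities `addRelX_eq_zero`, `addRelY_eq_zero`).
[cite: SilvermanATAEC1994, Thm. V.3.1 (c) (PDF pp. 396–398)] -/
theorem tatePointAlg_pow {K : Type u} [NontriviallyNormedField K] [CompleteSpace K]
    [IsUltrametricDist K] [CharZero K] {F : Type u} [NormedField F] [NormedAlgebra K F]
    [IsUltrametricDist F] [Algebra.IsAlgebraic K F] {q : K} (hq0 : q ≠ 0) (hq : ‖q‖ < 1)
    (u : Fˣ) (m : ℕ) : tatePointAlg q (u ^ m) = m • tatePointAlg q u := by
  induction m with
  | zero =>
    rw [pow_zero, zero_smul]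
    exact tatePointAlg_of_eq_zpow 1 (n := 0) (by simp)
  | succ m ih =>
    rw [pow_succ, tatePointAlg_mul addRelX_eq_zero addRelY_eq_zero hq0 hq, ih, succ_nsmul]

include h0 hα hE in
/-- **The Kummer tower is not Kummer-faithful**: every intermediate field `E` of `ℚ̄_p / ℚ_p`
containing a compatible system `(α_n)` of `ℓ^n`-th roots of `p` (`ℓ` prime) carries the Tate curve
`E_q`, `q = p`, with the non-zero infinitely divisible rational point `φ(α_1)`
(`ℓ^k · φ(α_{k+1}) = φ(α_1)`, `ℓ^{k+1} · φ(α_{k+1}) = O`), so the abelian-variety clause of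
[AbsTopIII] Def. 1.5 fails over `E`. [cite: MochizukiAbsTopIII2015, Rmk 1.5.3 (ii) p.33] -/
theorem not_isKummerFaithful_of_rootTower (hℓ : ℓ.Prime) : ¬ IsKummerFaithful (E : Type) := by
  -- one `DecidableEq` instance for the point groups throughout (the classical one of §1)
  letI : DecidableEq (E : Type) := fun a b => Classical.propDecidable (a = b)
  -- the normed, ultrametric, algebraic extension `E / ℚ_p`
  haveI : IsUltrametricDist E := IntermediateField.isUltrametricDist E
  set q : ℚ_[p] := (p : ℚ_[p]) with hq_def
  have hq0 : q ≠ 0 := natCast_padic_ne_zero (p := p)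
  have hq : ‖q‖ < 1 := norm_natCast_padic_lt_one (p := p)
  -- the normed `ℚ_p`-algebra structure of `E` packaged over the `IntermediateField` algebra structure
  -- (Mathlib's `SubalgebraClass.toNormedAlgebra` carries a non-reducibly-equal `Algebra` instance)
  letI instNA : NormedAlgebra ℚ_[p] E :=
    { (inferInstance : Algebra ℚ_[p] E) with
      norm_smul_le := fun c x => norm_smul_le c (x : PadicAlgCl p) }
  haveI : Algebra.IsAlgebraic ℚ_[p] E := inferInstance
  -- the Tate curve over `E`
  set W : WeierstrassCurve E := (tateCurve q).baseChange E with hW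
  haveI : W.IsElliptic := isElliptic_tateCurve_baseChange (F := (E : Type)) hq0 hq
  -- the units `α_n ∈ E^×`
  have hne : ∀ n, (⟨α n, hE n⟩ : E) ≠ 0 := fun n h =>
    rootTower_ne_zero h0 hα n (congrArg Subtype.val h)
  let u : ℕ → (E : Type)ˣ := fun n => Units.mk0 _ (hne n)
  have hu : ∀ n, u (n + 1) ^ ℓ = u n := fun n => Units.ext (Subtype.ext (by
    change (α (n + 1)) ^ ℓ = α n
    exact hα n))
  have hu0 : ∀ n, ((u n ^ ℓ ^ n : (E : Type)ˣ) : E) = algebraMap ℚ_[p] E q ^ (1 : ℤ) := fun n => by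
    rw [zpow_one]
    apply Subtype.ext
    change α n ^ ℓ ^ n = ((algebraMap ℚ_[p] (PadicAlgCl p)) (p : ℚ_[p]))
    rw [rootTower_pow h0 hα n, map_natCast]
  -- the Tate points `P_n = φ(α_n)`
  let P : ℕ → W.toAffine.Point := fun n => tatePointAlg q (u n)
  have hP1 : ∀ n, ℓ • P (n + 1) = P n := fun n => by
    change ℓ • tatePointAlg q (u (n + 1)) = tatePointAlg q (u n)
    rw [← tatePointAlg_pow hq0 hq, hu n]
  have hP2 : ∀ n, ℓ ^ n • P n = 0 := fun n => by
    change ℓ ^ n • tatePointAlg q (u n) = 0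
    rw [← tatePointAlg_pow hq0 hq]
    exact tatePointAlg_of_eq_zpow _ (hu0 n)
  have hP3 : P 1 ≠ 0 := by
    intro h
    obtain ⟨m, hm⟩ := (tatePointAlg_eq_zero_iff hq0 hq (u 1)).mp h
    apply rootTower_one_ne_zpow h0 hα hℓ m
    have h2 := congrArg (algebraMap E (PadicAlgCl p)) hm
    rw [map_zpow₀, ← IsScalarTower.algebraMap_apply] at h2
    exact h2
  have hk1 : ∀ k, ℓ ^ k • P (k + 1) = P 1 := fun k => by
    induction k with
    | zero => simp
    | succ k ih => rw [pow_succ, mul_smul, hP1 (k + 1), ih]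
  have hdivP : ∀ N : ℕ, 0 < N → ∃ Q : W.toAffine.Point, N • Q = P 1 :=
    forall_exists_nsmul_eq_of_prime_tower hℓ (P 1) (fun k => P (k + 1)) hk1 (fun k => hP2 (k + 1))
  -- transport along `W.baseChange E = W`
  have hWW : W.baseChange E = W := by
    change W.map (algebraMap E E) = W
    rw [Algebra.algebraMap_self, WeierstrassCurve.map_id]
  let e : W.toAffine.Point ≃+ (W.baseChange E).toAffine.Point :=
    WeierstrassCurve.Affine.Point.congrEquiv hWW.symm
  refine not_isKummerFaithful_of_divisible_point W (e (P 1)) ?_ fun N hN => ?_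
  · exact fun h => hP3 (e.injective (by rw [h, map_zero]))
  · obtain ⟨Q, hQ⟩ := hdivP N hN
    exact ⟨e Q, (map_nsmul e N Q).symm.trans (congrArg e hQ)⟩

end Tower

end Literature.AnabelianGeometry.AbsoluteAnabelian.AbsTopIII

end
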